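import Summits.Ventures.Crystal3D.StickySpheres.ContactGraph
import Literature.MathematicalPhysics.StatisticalMechanics.BarlowCoordination
import HarnessLib

/-!
# The layer bound: a cluster on one Barlow stacking has deficiency `≥ 3 ×` any layer occupancy

HONEST FRAMING. Part of the venture `Summits/Ventures/Crystal3D` (cells `pub-crystal3d`,
`crystal3d-full`). An exact ON-LATTICE counting lemma for packings drawn from one touching Barlow
stacking `barlowStacking 1 √(2/3) σ` (any Hägg sequence `σ`); nothing here is a claim about
off-lattice packings, ground states or three-dimensional crystallization.

**Theorem** (`three_mul_card_layer_add_numContacts_le`). If the centres of a unit packing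
`x : Fin N → ℝ³` all lie on `barlowStacking 1 √(2/3) σ`, then for EVERY layer `l`
`3 · #{i | x i ∈ layer l} + numContacts x ≤ 6N`, i.e. the contact deficiency `6N − C(x)` is at
least three times the number of balls in any single layer — uniformly in the Hägg word `σ`, with no
error term.  This is the «up-hollow double count» behind the in-registry rungs `RegistryNoGain111`
/ `BarlowAxisNoGain` of the cell `crystal3d-full` (HOME/cf-p1/ROUTE.md §12.4, §18; typed in
HOME/cf-p1/lean/WulffSelection.lean): with a basal slab sample of lateral radius `ρ` inside `x`,
some
layer carries `≥ (2/√3)πρ² − O(ρ)` balls, whence `D(x) ≥ 2√3·πρ² − O(ρ)` = the deficiency of the two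
flat basal faces; the lattice-point count of the disc is NOT done here.

**Proof** (ordered contact pairs, `BarlowCoordination.dist_barlowPos_eq_iff`). Touching sites lie
in the same layer (`≤ 6` partners, offsets `sixOffsets`) or in adjacent layers (`≤ 3` partners
above, offsets `threeOffsets (−σ k)`; `≤ 3` below).  So `2C = #same + 2·#up` with
`#same ≤ 6N`, and every upward pair `(i, j)` (`j` one layer above `i`) can be charged to a ball
OUTSIDE layer `l`: to `j` if `i` is in layer `≥ l`, to `i` otherwise; a ball receives at most `3`
charges.  Hence `#up ≤ 3(N − E_l)` and `2C ≤ 12N − 6E_l`.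

Also: the translated version `three_mul_card_layer_add_numContacts_le_of_sub_mem` (packings on a
translate `v + barlowStacking 1 √(2/3) σ`, e.g. the registered stackings `m·w + …` of the cell's
`registeredStacking σ m`).

WHAT THIS IS NOT: no lattice-point counting, no `O(ρ)` asymptotics, nothing off-lattice; rung F-C1
of the cell is not moved by an on-lattice lemma.
-/

noncomputable section

namespace Summit.Ventures.Crystal3D

open Finset
open Literature.MathematicalPhysics.StatisticalMechanics (barlowPos barlowLayer barlowStacking
  IsHaggSeq sixOffsets threeOffsets card_sixOffsets card_threeOffsets dist_barlowPos_eq_iff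
  le_dist_barlowPos_of_ideal)

/-- **The layer bound.** For a Hägg sequence `σ`, a unit packing `x : Fin N → ℝ³` with all
centres on `barlowStacking 1 √(2/3) σ`, and any layer index `l`:
`3 · #{i | x i ∈ barlowLayer 1 √(2/3) σ l} + numContacts x ≤ 6 N`. -/
theorem three_mul_card_layer_add_numContacts_le (σ : ℤ → ℤ) (hσ : IsHaggSeq σ) {N : ℕ}
    (x : Fin N → EuclideanSpace ℝ (Fin 3)) (hx : IsUnitPacking x)
    (hmem : ∀ i, x i ∈ barlowStacking 1 (Real.sqrt (2 / 3)) σ) (l : ℤ)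
    [DecidablePred fun i : Fin N => x i ∈ barlowLayer 1 (Real.sqrt (2 / 3)) σ l] :
    3 * (univ.filter fun i => x i ∈ barlowLayer 1 (Real.sqrt (2 / 3)) σ l).card +
      numContacts x ≤ 6 * N := by
  classical
  have hh : (Real.sqrt (2 / 3)) ^ 2 = 2 / 3 * (1 : ℝ) ^ 2 := by
    rw [Real.sq_sqrt (by norm_num)]; ring
  -- coordinates
  have hcoord : ∀ i, ∃ k a b : ℤ, x i = barlowPos 1 (Real.sqrt (2 / 3)) σ k a b := fun i => hmem i
  choose k a b hc using hcoord
  have hinjx := hx.injective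
  -- equal positions have equal coordinates (ideal stackings are `1`-separated)
  have hpos_inj : ∀ {k₁ a₁ b₁ k₂ a₂ b₂ : ℤ},
      barlowPos 1 (Real.sqrt (2 / 3)) σ k₁ a₁ b₁ = barlowPos 1 (Real.sqrt (2 / 3)) σ k₂ a₂ b₂ →
        (k₁, a₁, b₁) = (k₂, a₂, b₂) := by
    intro k₁ a₁ b₁ k₂ a₂ b₂ heq
    by_contra hne
    have h1 := le_dist_barlowPos_of_ideal hσ one_pos hh hne
    rw [heq, dist_self] at h1
    exact absurd h1 (by norm_num)
  -- layer membership is `k i = l`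
  have hlayer : ∀ i, x i ∈ barlowLayer 1 (Real.sqrt (2 / 3)) σ l ↔ k i = l := by
    intro i
    constructor
    · rintro ⟨a', b', h⟩
      rw [hc i] at h
      have := hpos_inj h
      simp only [Prod.mk.injEq] at this
      exact this.1
    · intro h
      exact ⟨a i, b i, by rw [hc i, h]⟩
  -- the shell of a site
  have hshell : ∀ i j, dist (x i) (x j) = 1 →
      (k j = k i ∧ (a i - a j, b i - b j) ∈ sixOffsets) ∨
      (k j = k i + 1 ∧ (a i - a j, b i - b j) ∈ threeOffsets (-σ (k i))) ∨
      (k j = k i - 1 ∧ (a i - a j, b i - b j) ∈ threeOffsets (σ (k i - 1))) := by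
    intro i j hd
    rw [hc i, hc j] at hd
    exact (dist_barlowPos_eq_iff hσ one_pos hh _ _ _ _ _ _).1 hd
  -- the offset map is injective on the balls of a fixed layer
  have hoff_inj : ∀ i (S : Finset (Fin N)) (m : ℤ), (∀ j ∈ S, k j = m) →
      Set.InjOn (fun j => (a i - a j, b i - b j)) ↑S := by
    intro i S m hS j hj j' hj' heq
    simp only [Prod.mk.injEq] at heq
    apply hinjx
    rw [hc j, hc j', hS j (mem_coe.1 hj), hS j' (mem_coe.1 hj'), show a j = a j' by omega,
      show b j = b j' by omega]
  -- ordered touching pairs and their three kinds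
  set P : Finset (Fin N × Fin N) :=
    univ.filter fun p => p.1 ≠ p.2 ∧ dist (x p.1) (x p.2) = 1 with hP
  set Psame := P.filter fun p => k p.2 = k p.1 with hPsame
  set Pup := P.filter fun p => k p.2 = k p.1 + 1 with hPup
  set Pdown := P.filter fun p => k p.2 = k p.1 - 1 with hPdown
  -- `#P = 2 C`
  have hPcard : P.card = 2 * numContacts x := by
    rw [← sum_coordination_eq, hP, card_filter, Fintype.sum_prod_type]
    refine sum_congr rfl fun i _ => ?_
    rw [coordination, contactNeighbors, card_filter]
    refine sum_congr rfl fun j _ => ?_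
    by_cases hij : j = i
    · subst hij; simp
    · simp [hij, Ne.symm hij]
  -- the three kinds exhaust `P`
  have hsplit : P.card = Psame.card + Pup.card + Pdown.card := by
    have h1 := card_filter_add_card_filter_not (s := P) (fun p => k p.2 = k p.1)
    have h2 := card_filter_add_card_filter_not (s := P.filter fun p => ¬ k p.2 = k p.1)
      (fun p => k p.2 = k p.1 + 1)
    have hup' : (P.filter fun p => ¬ k p.2 = k p.1).filter (fun p => k p.2 = k p.1 + 1) = Pup := by
      rw [hPup, filter_filter]
      exact filter_congr fun p _ => ⟨fun h => h.2, fun h => ⟨by omega, h⟩⟩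
    have hdown' : (P.filter fun p => ¬ k p.2 = k p.1).filter (fun p => ¬ k p.2 = k p.1 + 1) =
        Pdown := by
      rw [hPdown, filter_filter]
      refine filter_congr fun p hp => ⟨fun h => ?_, fun h => ⟨by omega, by omega⟩⟩
      have hp' := (mem_filter.1 hp).2
      rcases hshell p.1 p.2 hp'.2 with ⟨h', -⟩ | ⟨h', -⟩ | ⟨h', -⟩
      · exact absurd h' h.1
      · exact absurd h' h.2
      · exact h'
    rw [hup', hdown'] at h2
    rw [← hPsame] at h1
    omega
  -- down pairs are swapped up pairs
  have hswap : Pdown.card = Pup.card := by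
    rw [← card_map ⟨Prod.swap, Prod.swap_injective⟩]
    congr 1
    ext p
    simp only [mem_map, Function.Embedding.coeFn_mk, hPup, hPdown, hP, mem_filter, mem_univ,
      true_and, Prod.exists, Prod.swap_prod_mk]
    constructor
    · rintro ⟨c, d, ⟨⟨hne, hd⟩, hk⟩, rfl⟩
      exact ⟨⟨hne.symm, by rw [dist_comm]; exact hd⟩, by simp only; omega⟩
    · rintro ⟨⟨hne, hd⟩, hk⟩
      exact ⟨p.2, p.1, ⟨⟨hne.symm, by rw [dist_comm]; exact hd⟩, by omega⟩, rfl⟩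
  -- same-layer pairs: at most six per ball
  have hsame : Psame.card ≤ 6 * N := by
    have hfib : ∀ i ∈ Psame.image Prod.fst, (Psame.filter fun p => p.1 = i).card ≤ 6 := by
      intro i _
      -- the partners of `i` in its own layer
      set S := (Psame.filter fun p => p.1 = i).image Prod.snd with hS
      have hScard : (Psame.filter fun p => p.1 = i).card = S.card := by
        rw [hS, card_image_of_injOn]
        rintro p hp q hq (h : p.2 = q.2)
        have hp1 : p.1 = i := (mem_filter.1 (mem_coe.1 hp)).2
        have hq1 : q.1 = i := (mem_filter.1 (mem_coe.1 hq)).2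
        exact Prod.ext (hp1.trans hq1.symm) h
      have hSlayer : ∀ j ∈ S, k j = k i := by
        intro j hj
        obtain ⟨p, hp, rfl⟩ := mem_image.1 hj
        rw [mem_filter] at hp
        have := (mem_filter.1 hp.1).2
        rw [← hp.2]; exact this
      have hSoff : ∀ j ∈ S, (a i - a j, b i - b j) ∈ sixOffsets := by
        intro j hj
        obtain ⟨p, hp, rfl⟩ := mem_image.1 hj
        rw [mem_filter] at hp
        obtain ⟨hpP, hk⟩ := mem_filter.1 hp.1
        have hd := (mem_filter.1 hpP).2.2
        rw [hp.2] at hd hk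
        rcases hshell i p.2 hd with ⟨-, h⟩ | ⟨h, -⟩ | ⟨h, -⟩
        · exact h
        · omega
        · omega
      rw [hScard, ← card_sixOffsets, ← card_image_of_injOn (hoff_inj i S (k i) hSlayer)]
      exact card_le_card fun v hv => by
        obtain ⟨j, hj, rfl⟩ := mem_image.1 hv
        exact hSoff j hj
    have h := card_le_mul_card_image Psame 6 hfib
    have himg : (Psame.image Prod.fst).card ≤ N :=
      (card_le_univ _).trans (by rw [Fintype.card_fin])
    calc Psame.card ≤ 6 * (Psame.image Prod.fst).card := h
      _ ≤ 6 * N := Nat.mul_le_mul_left 6 himg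
  -- upward pairs: charge each to a ball outside layer `l`
  set E := (univ.filter fun i => x i ∈ barlowLayer 1 (Real.sqrt (2 / 3)) σ l) with hE
  have hEk : E = univ.filter fun i => k i = l := by
    rw [hE]; exact filter_congr fun i _ => hlayer i
  set f : Fin N × Fin N → Fin N := fun p => if l ≤ k p.1 then p.2 else p.1 with hf
  have hup : Pup.card ≤ 3 * (N - E.card) := by
    have hfib : ∀ z ∈ Pup.image f, (Pup.filter fun p => f p = z).card ≤ 3 := by
      intro z _
      by_cases hz : l < k z
      · -- charges come from below: `p = (i, z)` with `i` a lower neighbour of `z`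
        set S := (Pup.filter fun p => f p = z).image Prod.fst with hS
        have hmemS : ∀ p ∈ Pup.filter (fun p => f p = z), p.2 = z ∧ k p.1 = k z - 1 ∧
            dist (x z) (x p.1) = 1 := by
          intro p hp
          obtain ⟨hpP, hfp⟩ := mem_filter.1 hp
          obtain ⟨hpP', hk⟩ := mem_filter.1 hpP
          have hd := (mem_filter.1 hpP').2.2
          by_cases hle : l ≤ k p.1
          · rw [hf] at hfp; simp only [hle, if_true] at hfp
            subst hfp
            exact ⟨rfl, by omega, by rw [dist_comm]; exact hd⟩
          · rw [hf] at hfp; simp only [hle, if_false] at hfp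
            subst hfp; omega
        have hScard : (Pup.filter fun p => f p = z).card = S.card := by
          rw [hS, card_image_of_injOn]
          rintro p hp q hq (h : p.1 = q.1)
          exact Prod.ext h (((hmemS p (mem_coe.1 hp)).1).trans (hmemS q (mem_coe.1 hq)).1.symm)
        have hSlayer : ∀ i ∈ S, k i = k z - 1 := by
          intro i hi
          obtain ⟨p, hp, rfl⟩ := mem_image.1 hi
          exact (hmemS p hp).2.1
        have hSoff : ∀ i ∈ S, (a z - a i, b z - b i) ∈ threeOffsets (σ (k z - 1)) := by
          intro i hi
          obtain ⟨p, hp, rfl⟩ := mem_image.1 hi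
          obtain ⟨-, hk, hd⟩ := hmemS p hp
          rcases hshell z p.1 hd with ⟨h, -⟩ | ⟨h, -⟩ | ⟨-, h⟩
          · omega
          · omega
          · exact h
        rw [hScard, ← card_threeOffsets (σ (k z - 1)),
          ← card_image_of_injOn (hoff_inj z S (k z - 1) hSlayer)]
        exact card_le_card fun v hv => by
          obtain ⟨i, hi, rfl⟩ := mem_image.1 hv
          exact hSoff i hi
      · -- charges come from above: `p = (z, j)` with `j` an upper neighbour of `z`
        set S := (Pup.filter fun p => f p = z).image Prod.snd with hS
        have hmemS : ∀ p ∈ Pup.filter (fun p => f p = z), p.1 = z ∧ k p.2 = k z + 1 ∧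
            dist (x z) (x p.2) = 1 := by
          intro p hp
          obtain ⟨hpP, hfp⟩ := mem_filter.1 hp
          obtain ⟨hpP', hk⟩ := mem_filter.1 hpP
          have hd := (mem_filter.1 hpP').2.2
          by_cases hle : l ≤ k p.1
          · rw [hf] at hfp; simp only [hle, if_true] at hfp
            subst hfp; omega
          · rw [hf] at hfp; simp only [hle, if_false] at hfp
            subst hfp
            exact ⟨rfl, by omega, hd⟩
        have hScard : (Pup.filter fun p => f p = z).card = S.card := by
          rw [hS, card_image_of_injOn]
          rintro p hp q hq (h : p.2 = q.2)
          exact Prod.ext (((hmemS p (mem_coe.1 hp)).1).trans (hmemS q (mem_coe.1 hq)).1.symm) h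
        have hSlayer : ∀ j ∈ S, k j = k z + 1 := by
          intro j hj
          obtain ⟨p, hp, rfl⟩ := mem_image.1 hj
          exact (hmemS p hp).2.1
        have hSoff : ∀ j ∈ S, (a z - a j, b z - b j) ∈ threeOffsets (-σ (k z)) := by
          intro j hj
          obtain ⟨p, hp, rfl⟩ := mem_image.1 hj
          obtain ⟨-, hk, hd⟩ := hmemS p hp
          rcases hshell z p.2 hd with ⟨h, -⟩ | ⟨-, h⟩ | ⟨h, -⟩
          · omega
          · exact h
          · omega
        rw [hScard, ← card_threeOffsets (-σ (k z)),
          ← card_image_of_injOn (hoff_inj z S (k z + 1) hSlayer)]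
        exact card_le_card fun v hv => by
          obtain ⟨j, hj, rfl⟩ := mem_image.1 hv
          exact hSoff j hj
    have h := card_le_mul_card_image Pup 3 hfib
    -- the charged balls lie outside layer `l`
    have himg : Pup.image f ⊆ univ.filter fun z => ¬ k z = l := by
      intro z hz
      obtain ⟨p, hp, rfl⟩ := mem_image.1 hz
      obtain ⟨-, hk⟩ := mem_filter.1 hp
      rw [mem_filter]
      refine ⟨mem_univ _, ?_⟩
      by_cases hle : l ≤ k p.1
      · rw [hf]; simp only [hle, if_true]; omega
      · rw [hf]; simp only [hle, if_false]; omega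
    have hcompl : (univ.filter fun z : Fin N => ¬ k z = l).card = N - E.card := by
      have := card_filter_add_card_filter_not (s := (univ : Finset (Fin N))) (fun z => k z = l)
      rw [card_univ, Fintype.card_fin, ← hEk] at this
      omega
    calc Pup.card ≤ 3 * (Pup.image f).card := h
      _ ≤ 3 * (univ.filter fun z : Fin N => ¬ k z = l).card :=
          Nat.mul_le_mul_left 3 (card_le_card himg)
      _ = 3 * (N - E.card) := by rw [hcompl]
  -- assemble
  have hEle : E.card ≤ N := (card_le_univ _).trans (by rw [Fintype.card_fin])
  have h2C : 2 * numContacts x ≤ 6 * N + 6 * (N - E.card) := by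
    rw [← hPcard, hsplit, hswap]; omega
  omega

/-- **The layer bound on a translate** `v + barlowStacking 1 √(2/3) σ` (e.g. the cell's
registered stackings `m·w + barlowStacking …`): if `x i − v` lies on the stacking for every `i`,
then `3 · #{i | x i − v ∈ layer l} + numContacts x ≤ 6N`. -/
theorem three_mul_card_layer_add_numContacts_le_of_sub_mem (σ : ℤ → ℤ) (hσ : IsHaggSeq σ)
    {N : ℕ} (x : Fin N → EuclideanSpace ℝ (Fin 3)) (hx : IsUnitPacking x)
    (v : EuclideanSpace ℝ (Fin 3))
    (hmem : ∀ i, x i - v ∈ barlowStacking 1 (Real.sqrt (2 / 3)) σ) (l : ℤ)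
    [DecidablePred fun i : Fin N => x i - v ∈ barlowLayer 1 (Real.sqrt (2 / 3)) σ l] :
    3 * (univ.filter fun i => x i - v ∈ barlowLayer 1 (Real.sqrt (2 / 3)) σ l).card +
      numContacts x ≤ 6 * N := by
  classical
  set y : Fin N → EuclideanSpace ℝ (Fin 3) := fun i => x i - v with hy
  have hyx : ∀ i j, dist (y i) (y j) = dist (x i) (x j) := fun i j => by
    simp only [hy, dist_sub_right]
  have hypack : IsUnitPacking y := fun i j hij => by
    show 1 ≤ dist (y i) (y j)
    rw [hyx]; exact hx hij
  have hC : numContacts y = numContacts x := by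
    unfold numContacts contactPairs
    simp only [hyx]
  have h := three_mul_card_layer_add_numContacts_le σ hσ y hypack hmem l
  rw [hC] at h
  convert h using 4

end Summit.Ventures.Crystal3D

end
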